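import Summits.QuantumFields.YangMills.Theorems.SpecificationCompactnessAveragingReverseAC
import Literature.MathematicalPhysics.QuantumFieldTheory.Balaban1983to89.T3UnitLawDensityEML
import Literature.MathematicalPhysics.QuantumFieldTheory.Balaban1983to89.T4ExpWindowSmallField

/-!
# STUB D of `SpecificationLimitAE`: Bałaban's unit-lattice density `ρ̂_K` is positive almost everywhere (SU(2), `γ > 0`)

Crux `SpecificationLimitAE` (stmt-QuantumFields-22688, route `SpecificationCompactness`, LINE 15 «cocycle_limit», planner
ym-idea-5 g10) registers the stub `stub_unitDensityPosAE`:

  `∀ F γ, 0 < γ → ∀ K, ∀ᵐ V ∂(fieldMeasure (F.P 0) 0 SU(2)), 0 < T3UnitLawDensityEML.unitDensity F γ K V`.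

This file PROVES exactly that statement (`unitDensityPosAE`, spelled out; the skeleton's `UnitDensityPosAE` is this `Prop`
with `pi0 F = fieldMeasure (F.P 0) 0 SU(2)` and `ud = unitDensity`).  MECHANISM.  `ρ₀ = e^{−β_K A} > 0` everywhere
(`boltzmann_pos`); `ρ_{k+1} = T_kρ_k` is (a version of) the Radon–Nikodym derivative `d(avg_k)_*(ρ_k dU)/dV`
(`AveragingRT.rnTransport = rnDensity` on non-negative densities), which is positive `dV`-a.e. as soon as
`dV ≪ (avg_k)_*(ρ_k dU)` (Mathlib `Measure.rnDeriv_pos'`, `rnDeriv_lt_top`) — and that REVERSE absolute continuity of the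
(0.4) averaging push-forward is `AveragingReverseAC.fieldMeasure_absolutelyContinuous_map_avgFun_withDensity` (any small-loop
average; here [Balaban1987RG1] (0.4) on `SU(2)`, whose guard radius `δ ≤ 1/3` leaves the open set `{δ < |g − 1|} ∋ exp(iπσ₁)` of
positive Haar measure).  Induction up to `k = K ≤ m + K`, then the level identification `unitShift` (Haar-preserving,
`measurePreserving_fieldShift`) carries positivity to the unit torus.

Rung R3 RECORD line: nothing here proves the crux's other stubs, the leaf, or the YM mass gap.  Width seat ym-line-sfw-p2-w2
g21 (cell ym-idea-1, free hands), for planner ym-idea-5's LINE 15.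
-/

set_option autoImplicit false

noncomputable section

open MeasureTheory
open Literature.MathematicalPhysics.QuantumFieldTheory.Balaban1983to89
open Literature.MathematicalPhysics.QuantumFieldTheory.Balaban1983to89.T4Continuum
open Literature.MathematicalPhysics.QuantumFieldTheory.Balaban1983to89.AveragingRT
open Literature.MathematicalPhysics.QuantumFieldTheory.Balaban1983to89.BlockAveraging
open Literature.MathematicalPhysics.QuantumFieldTheory.Balaban1983to89.Missing
open Literature.MathematicalPhysics.QuantumFieldTheory.Balaban1983to89.T3ContinuumYM3Torus
open Literature.MathematicalPhysics.QuantumFieldTheory.Balaban1983to89.T3LevelShift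
open Literature.MathematicalPhysics.QuantumFieldTheory.Balaban1983to89.T3NestedUnitLaws
open Literature.MathematicalPhysics.QuantumFieldTheory.Balaban1983to89.T3UnitLawDensityEML
open Summit.QuantumFields.YangMills.Theorems.AveragingReverseAC

namespace Summit.QuantumFields.YangMills.Theorems.UnitDensityPosAE

/-- **The (0.4) guard is not almost sure on `SU(2)`**: `Haar{g | δ ≤ |g − 1|} ≠ 0` for the printed small-loop average `ℰp`
(`δ = min(1/3, π/2) ≤ 1/3 < 2 = |exp(iπσ₁) − 1|`; open sets have positive Haar measure). [folklore] -/
theorem haar_setOf_delta_le_dist1_ne_zero :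
    (HaarData.haar : Measure (Matrix.specialUnitaryGroup (Fin 2) ℂ)) {g | ℰp.δ ≤ dist1 g} ≠ 0 := by
  have hcont : Continuous (dist1 : Matrix.specialUnitaryGroup (Fin 2) ℂ → ℝ) :=
    UnitaryModel.continuous_opDist1.comp (Literature.MathematicalPhysics.QuantumLattice.continuous_fundamentalRep (Fin 2))
  have hopen : IsOpen {g : Matrix.specialUnitaryGroup (Fin 2) ℂ | ℰp.δ < dist1 g} := isOpen_lt continuous_const hcont
  have hδ : (ℰp).δ ≤ 1 / 3 := by
    show (ExpMeanLog.expMeanLogSU (n := Fin 2)).δ ≤ 1 / 3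
    rw [ExpMeanLog.expMeanLogSU_δ]
    exact min_le_left _ _
  have hg0 : ℰp.δ < dist1 (T4HaarSU2ExpChart.expPoint (EuclideanSpace.single 0 Real.pi)) := by
    rw [T4ExpWindowSmallField.dist1_expPoint_eq, PiLp.norm_single, Real.norm_eq_abs, abs_of_pos Real.pi_pos,
      Real.sin_pi_div_two, abs_one, mul_one]
    linarith
  haveI : (HaarData.haar : Measure (Matrix.specialUnitaryGroup (Fin 2) ℂ)).IsHaarMeasure :=
    Measure.isHaarMeasure_haarMeasure _
  intro h0
  have hpos := hopen.measure_pos (HaarData.haar : Measure (Matrix.specialUnitaryGroup (Fin 2) ℂ)) ⟨_, hg0⟩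
  exact hpos.ne' (measure_mono_null (fun g (hg : ℰp.δ < dist1 g) => hg.le) h0)

/-- **REVERSE ABSOLUTE CONTINUITY OF ONE RENORMALISATION STEP of the `K`-th approximation** (`k + 1 ≤ m + K`): product Haar
on level `k+1` is absolutely continuous w.r.t. the (0.4) push-forward of `ρ_k dU` whenever `ρ_k > 0` a.e.
(`AveragingReverseAC.fieldMeasure_absolutelyContinuous_map_avgFun_withDensity` on `SU(2)`, `d = 3`). [cite: Balaban1985UV3, (2) p.256] -/
theorem fieldMeasure_absolutelyContinuous_pushDensity (F : T3Family) (γ : ℝ) (K k : ℕ) (hk : k + 1 ≤ F.m + K)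
    (hρ0 : ∀ᵐ U ∂(fieldMeasure (F.P K) k (Matrix.specialUnitaryGroup (Fin 2) ℂ)), 0 < emlDensity F γ K k U) :
    fieldMeasure (F.P K) (k+1) (Matrix.specialUnitaryGroup (Fin 2) ℂ) ≪
      pushDensity (BlockAveraging.blockAvg (P := F.P K) (j := k) ℰp).avg (emlDensity F γ K k) := by
  unfold pushDensity
  exact fieldMeasure_absolutelyContinuous_map_avgFun_withDensity (P := F.P K) (G := Matrix.specialUnitaryGroup (Fin 2) ℂ)
    hk (by rw [T3Family.P_d]; norm_num) ℰp measurableE_ℰp haar_setOf_delta_le_dist1_ne_zero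
    (measurable_emlDensity F γ K k).ennreal_ofReal.aemeasurable
    (hρ0.mono fun U hU => (ENNReal.ofReal_pos.mpr hU).ne')

/-- **`ρ_k > 0` ALMOST EVERYWHERE for `k ≤ m + K`** (`γ > 0`): `ρ₀ = e^{−β_K A} > 0`; `ρ_{k+1} = dν_k/dV` with
`ν_k = (avg_k)_*(ρ_k dU) ≫ dV` (the previous theorem), and a Radon–Nikodym derivative of a finite measure dominating the
reference measure is positive and finite a.e. (Mathlib `rnDeriv_pos'`, `rnDeriv_lt_top`). [cite: Balaban1985UV3, (2) p.256] -/
theorem emlDensity_pos_ae (F : T3Family) (γ : ℝ) (hγ : 0 < γ) (K : ℕ) : ∀ k : ℕ, k ≤ F.m + K →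
    ∀ᵐ V ∂(fieldMeasure (F.P K) k (Matrix.specialUnitaryGroup (Fin 2) ℂ)), 0 < emlDensity F γ K k V
  | 0, _ => ae_of_all _ fun V => by rw [emlDensity_zero]; exact boltzmann_pos _ _ V
  | k + 1, hk => by
    have ih := emlDensity_pos_ae F γ hγ K k (by omega)
    have hac := fieldMeasure_absolutelyContinuous_pushDensity F γ K k hk ih
    have hint := integrable_emlDensity F K hγ.le k (by omega)
    haveI : IsFiniteMeasure ((fieldMeasure (F.P K) k (Matrix.specialUnitaryGroup (Fin 2) ℂ)).withDensity
        fun U => ENNReal.ofReal (emlDensity F γ K k U)) :=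
      isFiniteMeasure_withDensity_ofReal hint.hasFiniteIntegral
    haveI : IsFiniteMeasure (pushDensity (BlockAveraging.blockAvg (P := F.P K) (j := k) ℰp).avg (emlDensity F γ K k)) := by
      unfold pushDensity; infer_instance
    have h1 := Measure.rnDeriv_pos' hac
    have h2 := Measure.rnDeriv_lt_top (pushDensity (BlockAveraging.blockAvg (P := F.P K) (j := k) ℰp).avg
      (emlDensity F γ K k)) (fieldMeasure (F.P K) (k+1) (Matrix.specialUnitaryGroup (Fin 2) ℂ))
    filter_upwards [h1, h2] with V hV1 hV2
    rw [emlDensity_succ F γ K hk]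
    show 0 < rnTransport (BlockAveraging.blockAvg (P := F.P K) (j := k) ℰp).avg (emlDensity F γ K k) V
    simp only [rnTransport, if_pos (emlDensity_nonneg F γ K k)]
    exact ENNReal.toReal_pos hV1.ne' hV2.ne

/-- **`ρ̂_K > 0` ALMOST EVERYWHERE ON THE UNIT TORUS** (`γ > 0`): `ρ̂_K = ρ_K ∘ unitShift⁻¹` and the level identification
preserves product Haar. [cite: Balaban1985UV3, (2) p.256] -/
theorem unitDensity_pos_ae (F : T3Family) (γ : ℝ) (hγ : 0 < γ) (K : ℕ) :
    ∀ᵐ u ∂(fieldMeasure (F.P 0) 0 (Matrix.specialUnitaryGroup (Fin 2) ℂ)), 0 < unitDensity F γ K u := by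
  have h := emlDensity_pos_ae F γ hγ K K (Nat.le_add_left K F.m)
  have h2 := (measurePreserving_fieldShift (G := Matrix.specialUnitaryGroup (Fin 2) ℂ)
    (F.sitesPerDir_unit K).symm).quasiMeasurePreserving.ae h
  exact h2

/-- **STUB D `stub_unitDensityPosAE` OF LINE 15 (crux `SpecificationLimitAE`), AS REGISTERED**: for every family `F`, every
`γ > 0` and every `K`, Bałaban's unit-lattice density `ρ̂_K` of [Balaban1985UV3] (2) (tree `T3UnitLawDensityEML.unitDensity`)
is positive almost everywhere for product Haar on the unit torus `T₁` of `SU(2)` — verbatim the skeleton's `UnitDensityPosAE`.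
[cite: Balaban1985UV3, (2) p.256] -/
theorem unitDensityPosAE : ∀ (F : T3Family) (γ : ℝ), 0 < γ → ∀ K : ℕ,
    ∀ᵐ V ∂(fieldMeasure (F.P 0) 0 (Matrix.specialUnitaryGroup (Fin 2) ℂ)), 0 < unitDensity F γ K V :=
  fun F γ hγ K => unitDensity_pos_ae F γ hγ K

end Summit.QuantumFields.YangMills.Theorems.UnitDensityPosAE
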